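import Mathlib.Probability.Martingale.Convergence
import Mathlib.MeasureTheory.Function.FactorsThrough
import Literature.Probability.LatticeModels.ReflectionPositivityProofs
import Literature.Probability.LatticeModels.GKSInequalities
import HarnessLib

/-!
# Reflection positivity: from local observables to all bounded measurable observables

Theorem-only file (no definitions, no named facts). Two closure properties of reflection
positivity of a measure `μ` on Ising configurations `{±1}^{ℤ^d}` (`IsReflectionPositive`,
`IsReflectionPositiveReal` of `ReflectionPositivity.lean`; Fröhlich–Israel–Lieb–Simon 1978 §2,
Biskup 2009 Def. 5.2), needed to pass reflection positivity from finite volumes (where it is an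
identity between finite sums, `InfraredBoundProofs.lean`) to infinite-volume Gibbs states, whose
local expectations are limits of finite-volume ones:

* `IsReflectionPositiveReal.isReflectionPositive` — **real ⇒ complex**: for complex `F = u + iv`,
  `Re (conj (F ∘ θ) · F) = (u ∘ θ) u + (v ∘ θ) v` pointwise, so positivity of the real form on
  real observables gives positivity of the sesquilinear form (no invariance is needed for this
  direction; cf. Biskup 2009, remark after Def. 5.2).
* `isReflectionPositiveReal_of_local`, `isReflectionPositive_of_local` — **local ⇒ bounded
  measurable**: if `μ` is a probability measure invariant under the configuration reflection
  `θ*` and `0 ≤ ∫ (G ∘ θ*) G dμ` for every real observable `G` depending on finitely many spins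
  in the positive half `P` (a LOCAL observable), then `0 ≤ ∫ (F ∘ θ*) F dμ` for every bounded real
  `F` measurable with respect to the spins in `P`, i.e. `IsReflectionPositiveReal μ θ P`, and
  hence `IsReflectionPositive μ θ P`. Proof: Lévy's upward theorem (Mathlib
  `Integrable.tendsto_ae_condExp`) along the filtration `𝓕_n = σ(spins in P ∩ Λ_n)` gives local
  approximants `G_n = μ[F | 𝓕_n] → F` a.e., bounded by `‖F‖_∞` (`ae_bdd_abs_condExp_of_ae_bdd_abs`),
  local because `𝓕_n`-measurable functions factor through the spins in `P ∩ Λ_n`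
  (`Measurable.factorsThrough`); `θ*`-invariance transports the a.e. statements to `G_n ∘ θ*`, and
  dominated convergence passes `0 ≤ ∫ (G_n ∘ θ*) G_n dμ` to the limit. This is the standard
  "weak limits of RP states are RP" step (Biskup 2009 §5; Fröhlich–Israel–Lieb–Simon 1978 §2)
  in the form needed by `IsReflectionPositive` (all bounded `𝔄₊`-measurable observables).

## References

* M. Biskup, *Reflection positivity and phase transitions in lattice spin models*, LNM 1970
  (2009), §5.1, Def. 5.2 and remarks. [Biskup2009]
* J. Fröhlich, R. Israel, E. H. Lieb, B. Simon, Comm. Math. Phys. 62 (1978) 1–34, §2. [FILS1978]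

Mathlib: `MeasureTheory.Filtration`, `Integrable.tendsto_ae_condExp` (Lévy upward / L¹ martingale
convergence), `ae_bdd_abs_condExp_of_ae_bdd_abs`, `stronglyMeasurable_condExp`,
`Measurable.factorsThrough`, `dependsOn_iff_factorsThrough`, `QuasiMeasurePreserving.ae`,
`tendsto_integral_of_dominated_convergence`.
-/

noncomputable section

open MeasureTheory Filter
open scoped Topology ComplexConjugate

namespace Literature.Probability.LatticeModels

/-! ### Real reflection positivity implies complex reflection positivity -/

section RealToComplex

variable {V S : Type*} [MeasurableSpace S]

/-- Pointwise identity behind "real RP ⇒ complex RP": for complex numbers,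
`Re (conj z · w) = Re z · Re w + Im z · Im w`. [folklore] -/
theorem conj_mul_re (z w : ℂ) : (conj z * w).re = z.re * w.re + z.im * w.im := by
  simp [Complex.mul_re]

/-- **Real reflection positivity implies complex reflection positivity** (finite measure): for a
bounded `𝔄₊`-measurable complex `F = u + iv` one has
`Re ∫ conj (F ∘ θ*) F dμ = ∫ (u ∘ θ*) u dμ + ∫ (v ∘ θ*) v dμ ≥ 0` (Biskup 2009, Def. 5.2, stated
for real observables; the sesquilinear form on complex observables is its complexification). [cite: Biskup2009, §5.1 Def. 5.2] -/
theorem IsReflectionPositiveReal.isReflectionPositive {μ : Measure (V → S)} [IsFiniteMeasure μ]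
    {θ : V ≃ V} {Vpos : Set V} (h : IsReflectionPositiveReal μ θ Vpos) :
    IsReflectionPositive μ θ Vpos := by
  intro F hF hFb
  obtain ⟨C, hC⟩ := hFb
  have hre : Measurable[positiveEvents Vpos] fun σ' => (F σ').re := Complex.measurable_re.comp hF
  have him : Measurable[positiveEvents Vpos] fun σ' => (F σ').im := Complex.measurable_im.comp hF
  have hreb : ∃ C, ∀ σ', ‖(F σ').re‖ ≤ C :=
    ⟨C, fun σ' => (RCLike.norm_re_le_norm (F σ')).trans (hC σ')⟩
  have himb : ∃ C, ∀ σ', ‖(F σ').im‖ ≤ C :=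
    ⟨C, fun σ' => (RCLike.norm_im_le_norm (F σ')).trans (hC σ')⟩
  have h1 := h _ hre hreb
  have h2 := h _ him himb
  have hint : Integrable (fun σ' => conj (F (configReflect θ σ')) * F σ') μ :=
    integrable_conj_comp_mul θ hF ⟨C, hC⟩ hF ⟨C, hC⟩
  -- real integrands are integrable (bounded and measurable)
  have hre' : Measurable fun σ' => (F σ').re := hre.mono cylinderEvents_le_pi le_rfl
  have him' : Measurable fun σ' => (F σ').im := him.mono cylinderEvents_le_pi le_rfl
  have hi1 : Integrable (fun σ' => (F (configReflect θ σ')).re * (F σ').re) μ := by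
    refine Integrable.of_bound ((hre'.comp (measurable_configReflect θ)).mul hre').aestronglyMeasurable
      (C * C) (ae_of_all _ fun σ' => ?_)
    rw [norm_mul]
    exact mul_le_mul ((RCLike.norm_re_le_norm _).trans (hC _)) ((RCLike.norm_re_le_norm _).trans (hC σ'))
      (norm_nonneg _) ((norm_nonneg _).trans (hC (configReflect θ σ')))
  have hi2 : Integrable (fun σ' => (F (configReflect θ σ')).im * (F σ').im) μ := by
    refine Integrable.of_bound ((him'.comp (measurable_configReflect θ)).mul him').aestronglyMeasurable
      (C * C) (ae_of_all _ fun σ' => ?_)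
    rw [norm_mul]
    exact mul_le_mul ((RCLike.norm_im_le_norm _).trans (hC _)) ((RCLike.norm_im_le_norm _).trans (hC σ'))
      (norm_nonneg _) ((norm_nonneg _).trans (hC (configReflect θ σ')))
  have key : (∫ σ', conj (F (configReflect θ σ')) * F σ' ∂μ).re =
      (∫ σ', (F (configReflect θ σ')).re * (F σ').re ∂μ) + ∫ σ', (F (configReflect θ σ')).im * (F σ').im ∂μ := by
    rw [← integral_add hi1 hi2]
    have := integral_re hint
    simp only [RCLike.re_to_complex] at this
    rw [← this]
    refine integral_congr_ae (ae_of_all _ fun σ' => ?_)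
    exact conj_mul_re _ _
  rw [key]
  exact add_nonneg h1 h2

end RealToComplex

/-! ### Local observables: finitely many spins, finitely many values -/

section Local

variable {d : ℕ}

/-- A real observable of `{±1}^{ℤ^d}` depending only on the spins in a finite window takes finitely
many values, hence is bounded. [folklore] -/
theorem exists_forall_abs_le_of_dependsOn (W : Finset (Site d)) {G : SpinConfig (Site d) → ℝ}
    (hG : DependsOn G (↑W : Set (Site d))) : ∃ C, ∀ σ, |G σ| ≤ C := by
  classical
  let e : (↥W → ℤˣ) → SpinConfig (Site d) := fun η x => if hx : x ∈ W then η ⟨x, hx⟩ else 1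
  obtain ⟨C, hC⟩ := Finite.exists_le fun η : ↥W → ℤˣ => |G (e η)|
  refine ⟨C, fun σ => ?_⟩
  have hσ : G σ = G (e fun x => σ x) := hG fun x hx => by simp [e, Finset.mem_coe.1 hx]
  rw [hσ]
  exact hC fun x => σ ↑x

/-- A `cylinderEvents Δ`-measurable real observable depends only on the spins in `Δ` (it factors
through the restriction to `Δ`; Mathlib `Measurable.factorsThrough`). [folklore] -/
theorem dependsOn_of_measurable_cylinderEvents {V S : Type*} [MeasurableSpace S] {Δ : Set V}
    {G : (V → S) → ℝ} (hG : Measurable[cylinderEvents (X := fun _ : V => S) Δ] G) : DependsOn G Δ := by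
  have hle : cylinderEvents (X := fun _ : V => S) Δ ≤
      MeasurableSpace.comap (Set.restrict Δ) (MeasurableSpace.pi) := by
    refine iSup₂_le fun i hi => ?_
    have : (fun σ : V → S => σ i) = (fun η : Δ → S => η ⟨i, hi⟩) ∘ Set.restrict Δ := rfl
    rw [this, ← MeasurableSpace.comap_comp]
    exact MeasurableSpace.comap_mono (measurable_pi_apply _).comap_le
  exact dependsOn_iff_factorsThrough.2 (hG.mono hle le_rfl).factorsThrough

end Local

/-! ### Local reflection positivity implies reflection positivity -/

section LocalToGlobal

variable {d : ℕ}

/-- **Reflection positivity passes from local observables to all bounded measurable ones.**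
Let `μ` be a probability measure on `{±1}^{ℤ^d}`, invariant under the configuration reflection
`θ*` of a lattice bijection `θ`, and suppose `0 ≤ ∫ (G ∘ θ*) · G dμ` for every real observable `G`
that is measurable and depends only on the spins in a finite set `W ⊆ P`. Then `μ` is reflection
positive (real form) with respect to `θ` and the half `P`: `0 ≤ ∫ (F ∘ θ*) · F dμ` for every
bounded real `F` measurable with respect to the spins in `P`. (The "weak limits of RP measures
are RP" step, Biskup 2009 §5 / FILS 1978 §2, completed by Lévy's upward martingale theorem:
`μ[F | σ(spins in P ∩ Λ_n)] → F` a.e. and boundedly, and each conditional expectation is a local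
observable in `P ∩ Λ_n`.) [cite: Biskup2009, §5.1 Def. 5.2] -/
theorem isReflectionPositiveReal_of_local {μ : Measure (SpinConfig (Site d))} [IsProbabilityMeasure μ]
    {θ : Site d ≃ Site d} (hinv : IsReflectionInvariant μ θ) {P : Set (Site d)}
    (hloc : ∀ W : Finset (Site d), (↑W : Set (Site d)) ⊆ P → ∀ G : SpinConfig (Site d) → ℝ,
      Measurable G → DependsOn G (↑W : Set (Site d)) → 0 ≤ ∫ σ, G (configReflect θ σ) * G σ ∂μ) :
    IsReflectionPositiveReal μ θ P := by
  classical
  intro F hF hFb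
  obtain ⟨C, hC⟩ := hFb
  have hC' : ∀ σ, |F σ| ≤ C := fun σ => by simpa [Real.norm_eq_abs] using hC σ
  -- the windows `W n = P ∩ Λ_n` and the filtration they generate
  let W : ℕ → Finset (Site d) := fun n => (box d n).filter fun x => x ∈ P
  have hWP : ∀ n, (↑(W n) : Set (Site d)) ⊆ P := fun n x hx => by
    simp only [W, Finset.coe_filter, Set.mem_setOf_eq] at hx
    exact hx.2
  have hWmono : ∀ m n, m ≤ n → (↑(W m) : Set (Site d)) ⊆ ↑(W n) := fun m n hmn x hx => by
    simp only [W, Finset.coe_filter, Set.mem_setOf_eq] at hx ⊢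
    exact ⟨box_mono d hmn hx.1, hx.2⟩
  let ℱ : Filtration ℕ (MeasurableSpace.pi : MeasurableSpace (SpinConfig (Site d))) :=
    { seq := fun n => cylinderEvents (X := fun _ : Site d => ℤˣ) ↑(W n)
      mono' := fun m n hmn => cylinderEvents_mono (hWmono m n hmn)
      le' := fun _ => cylinderEvents_le_pi }
  -- `F` is measurable for `⨆ n, ℱ n ⊇ 𝔄₊`
  have hsup : positiveEvents (S := ℤˣ) P ≤ ⨆ n, (ℱ n : MeasurableSpace (SpinConfig (Site d))) := by
    refine iSup₂_le fun x hx => ?_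
    obtain ⟨n, hn⟩ := exists_forall_subset_box (d := d) {x}
    have hxW : x ∈ (↑(W n) : Set (Site d)) := by
      simp only [W, Finset.coe_filter, Set.mem_setOf_eq]
      exact ⟨hn n le_rfl (Finset.mem_singleton_self x), hx⟩
    calc MeasurableSpace.comap (fun σ : SpinConfig (Site d) => σ x) inferInstance
        ≤ (ℱ n : MeasurableSpace (SpinConfig (Site d))) := le_iSup₂_of_le x hxW le_rfl
      _ ≤ ⨆ n, (ℱ n : MeasurableSpace (SpinConfig (Site d))) :=
          le_iSup (fun n => (ℱ n : MeasurableSpace (SpinConfig (Site d)))) n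
  have hFpi : Measurable F := hF.mono cylinderEvents_le_pi le_rfl
  have hFm' : StronglyMeasurable[⨆ n, (ℱ n : MeasurableSpace (SpinConfig (Site d)))] F :=
    (hF.mono hsup le_rfl).stronglyMeasurable
  have hFint : Integrable F μ :=
    Integrable.of_bound hFpi.aestronglyMeasurable C (ae_of_all _ hC)
  -- the local approximants `G n = μ[F | ℱ n]`
  set G : ℕ → SpinConfig (Site d) → ℝ := fun n => μ[F | ℱ n] with hGdef
  have hGm : ∀ n, Measurable (G n) := fun n =>
    (stronglyMeasurable_condExp (m := ℱ n) (μ := μ) (f := F)).measurable.mono (ℱ.le n) le_rfl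
  have hGdep : ∀ n, DependsOn (G n) (↑(W n) : Set (Site d)) := fun n =>
    dependsOn_of_measurable_cylinderEvents
      (stronglyMeasurable_condExp (m := ℱ n) (μ := μ) (f := F)).measurable
  have hGpos : ∀ n, 0 ≤ ∫ σ, G n (configReflect θ σ) * G n σ ∂μ := fun n =>
    hloc (W n) (hWP n) (G n) (hGm n) (hGdep n)
  -- a.e. convergence and bounds, transported along `θ*` by invariance
  have hqmp : Measure.QuasiMeasurePreserving (configReflect θ) μ μ :=
    ⟨measurable_configReflect θ, by rw [hinv]⟩
  have hae : ∀ᵐ σ ∂μ, Tendsto (fun n => G n σ) atTop (𝓝 (F σ)) := hFint.tendsto_ae_condExp hFm'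
  have hae' : ∀ᵐ σ ∂μ, Tendsto (fun n => G n (configReflect θ σ)) atTop (𝓝 (F (configReflect θ σ))) :=
    hqmp.ae hae
  have hGbdd : ∀ n, ∀ᵐ σ ∂μ, |G n σ| ≤ C := fun n =>
    ae_bdd_abs_condExp_of_ae_bdd_abs (ae_of_all _ hC')
  have hGbdd' : ∀ n, ∀ᵐ σ ∂μ, |G n (configReflect θ σ)| ≤ C := fun n => hqmp.ae (hGbdd n)
  -- dominated convergence
  have hlim : Tendsto (fun n => ∫ σ, G n (configReflect θ σ) * G n σ ∂μ) atTop
      (𝓝 (∫ σ, F (configReflect θ σ) * F σ ∂μ)) := by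
    refine tendsto_integral_of_dominated_convergence (fun _ => C * C) (fun n => ?_)
      (integrable_const _) (fun n => ?_) ?_
    · exact (((hGm n).comp (measurable_configReflect θ)).mul (hGm n)).aestronglyMeasurable
    · filter_upwards [hGbdd n, hGbdd' n] with σ h1 h2
      rw [Real.norm_eq_abs, abs_mul]
      exact mul_le_mul h2 h1 (abs_nonneg _) ((abs_nonneg _).trans h2)
    · filter_upwards [hae, hae'] with σ h1 h2
      exact h2.mul h1
  exact ge_of_tendsto' hlim hGpos

/-- **Local reflection positivity implies reflection positivity (complex form).** Under the
hypotheses of `isReflectionPositiveReal_of_local`, `μ` is reflection positive with respect to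
`θ` and `P` in the sense of `IsReflectionPositive` (all bounded complex `𝔄₊`-measurable
observables; FILS 1978 §2, Biskup 2009 Def. 5.2). [cite: Biskup2009, §5.1 Def. 5.2] -/
theorem isReflectionPositive_of_local {μ : Measure (SpinConfig (Site d))} [IsProbabilityMeasure μ]
    {θ : Site d ≃ Site d} (hinv : IsReflectionInvariant μ θ) {P : Set (Site d)}
    (hloc : ∀ W : Finset (Site d), (↑W : Set (Site d)) ⊆ P → ∀ G : SpinConfig (Site d) → ℝ,
      Measurable G → DependsOn G (↑W : Set (Site d)) → 0 ≤ ∫ σ, G (configReflect θ σ) * G σ ∂μ) :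
    IsReflectionPositive μ θ P :=
  (isReflectionPositiveReal_of_local hinv hloc).isReflectionPositive

end LocalToGlobal

end Literature.Probability.LatticeModels
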